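import Summits.QuantumFields.YangMills.Theorems.VirialFluxGapCentralLiftProximity
import HarnessLib

/-!
# Route `VirialFluxGap` (YangMills): real-arithmetic BOUNDS for the per-variable traces of the explicit central field — `≤ 3` (plain), `≤ 3 − (3/2)/N + 3ρ²/N`
# (wrap-block ∕ seam) — the (E2) budget `18L⁴ − 3 + O(ρ²)` slot by slot (central chart C1 of ⟨stmt-QuantumFields-24141⟩; free-hands helper)

Width seat `ym-line-sfw-p2-w3` g59 (cell ym-idea-1, free hands), `--supports stmt-QuantumFields-24141`.

The per-variable divergence of the explicit central field at a wrap-block ∕ seam variable is (⧗`centralCoord_wrap_trace`, `…_seam_trace`)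
`T = 3(σ r q₀ + z·p) − N⁻¹(3q₀² + 2|p|² + σ r⁻¹ q₀ (z·p)) + (3/2)σ q₀/N` with `q = (q₀,p)` the variable's unit quaternion, `z` the block average, `r = √(1−|z|²)`,
`σ = ±1`, `N` the block size.  This file is the elementary arithmetic turning it into the budget used by the divergence clause:

* `re_anchor_le_one` — `σ r q₀ + z·p ≤ 1` (it is `Re(conj(lift σ z)·q)`, a product of unit quaternions; here directly by Cauchy–Schwarz);
* ★★ `central_trace_le` — for `σ = ±1`, `q₀² + |p|² = 1`, `|z|² ≤ ρ²`, `|p|² ≤ ρ²`, `ρ² ≤ ½`, `0 < N`:  `T ≤ 3 − (3/2)/N + 3ρ²/N`;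
* `central_trace_sum_budget` — summing `N` such slots gives `≤ 3N − 3/2 + 3ρ²`, so four blocks and the plain slots (`≤ 3` each, ⧗`centralDiv_plain_le`) give
  `Σ ≤ 3·#slots − 6 + 12ρ² = 18L⁴ − 3 + 12ρ²` on `X_fix` (`#slots = 6L⁴ + 1`): the arithmetic identity `budget_arith`.

HONEST LABEL: real arithmetic only; ⟨24141⟩ and ⟨22884⟩ stay OPEN; the Yang–Mills mass gap is NOT proved by this; no summit is proved by a line.  THEOREMS ONLY.

References: [cite: CosteEtAl1985].
-/

set_option autoImplicit false

noncomputable section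

namespace Summit.QuantumFields.YangMills.Theorems.VirialFluxGap.CentralField

open Summit.QuantumFields.YangMills.Theorems.VirialFluxGap.CentralCoercivity (dot3_sq_le)

/-- `σ r q₀ + z·p ≤ 1` for `σ² = 1`, `r = √(1−|z|²)` (`|z|² ≤ 1`), `q₀² + |p|² = 1` (Cauchy–Schwarz in `ℝ⁴`). [folklore] -/
theorem re_anchor_le_one {σ q₀ : ℝ} {z p : Fin 3 → ℝ} (hσ : σ ^ 2 = 1) (hz : (z 0) ^ 2 + (z 1) ^ 2 + (z 2) ^ 2 ≤ 1)
    (hq : q₀ ^ 2 + ((p 0) ^ 2 + (p 1) ^ 2 + (p 2) ^ 2) = 1) :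
    σ * Real.sqrt (1 - ((z 0) ^ 2 + (z 1) ^ 2 + (z 2) ^ 2)) * q₀ + (z 0 * p 0 + z 1 * p 1 + z 2 * p 2) ≤ 1 := by
  set r := Real.sqrt (1 - ((z 0) ^ 2 + (z 1) ^ 2 + (z 2) ^ 2)) with hr
  have hr2 : r ^ 2 = 1 - ((z 0) ^ 2 + (z 1) ^ 2 + (z 2) ^ 2) := Real.sq_sqrt (by linarith)
  -- `(σr, z)` and `(q₀, p)` are unit vectors of `ℝ⁴`
  nlinarith [sq_nonneg (σ * r - q₀), sq_nonneg (z 0 - p 0), sq_nonneg (z 1 - p 1), sq_nonneg (z 2 - p 2), hσ, hr2]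

/-- ★★ **The per-variable trace budget**: for `σ = ±1`, a unit variable quaternion `q₀² + |p|² = 1` with `|p|² ≤ ρ²`, block data `|z|² ≤ ρ²`, `ρ² ≤ ½`, and
block size `N > 0`, the trace `T` of the explicit central field at the variable satisfies `T ≤ 3 − (3/2)/N + 3ρ²/N`. [cite: CosteEtAl1985] -/
theorem central_trace_le {σ q₀ N ρ : ℝ} {z p : Fin 3 → ℝ} (hσ : σ = 1 ∨ σ = -1) (hq : q₀ ^ 2 + ((p 0) ^ 2 + (p 1) ^ 2 + (p 2) ^ 2) = 1)
    (hp : (p 0) ^ 2 + (p 1) ^ 2 + (p 2) ^ 2 ≤ ρ ^ 2) (hz : (z 0) ^ 2 + (z 1) ^ 2 + (z 2) ^ 2 ≤ ρ ^ 2) (hρ : ρ ^ 2 ≤ 1 / 2) (hN : 0 < N) :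
    3 * (σ * Real.sqrt (1 - ((z 0) ^ 2 + (z 1) ^ 2 + (z 2) ^ 2)) * q₀ + (z 0 * p 0 + z 1 * p 1 + z 2 * p 2)) -
        (3 * q₀ ^ 2 + 2 * ((p 0) ^ 2 + (p 1) ^ 2 + (p 2) ^ 2) +
          σ * (Real.sqrt (1 - ((z 0) ^ 2 + (z 1) ^ 2 + (z 2) ^ 2)))⁻¹ * q₀ * (z 0 * p 0 + z 1 * p 1 + z 2 * p 2)) / N +
        (3 / 2 : ℝ) * σ * q₀ / N ≤
      3 - (3 / 2) / N + 3 * ρ ^ 2 / N := by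
  have hσ2 : σ ^ 2 = 1 := by rcases hσ with h | h <;> simp [h]
  have hz1 : (z 0) ^ 2 + (z 1) ^ 2 + (z 2) ^ 2 ≤ 1 := by linarith
  set r := Real.sqrt (1 - ((z 0) ^ 2 + (z 1) ^ 2 + (z 2) ^ 2)) with hr
  have hr2 : r ^ 2 = 1 - ((z 0) ^ 2 + (z 1) ^ 2 + (z 2) ^ 2) := Real.sq_sqrt (by linarith)
  have hrpos : 0 < r := Real.sqrt_pos.2 (by linarith)
  have hrhalf : 1 / 2 ≤ r ^ 2 := by rw [hr2]; linarith
  -- (1) the anchored real part is at most one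
  have h1 : σ * r * q₀ + (z 0 * p 0 + z 1 * p 1 + z 2 * p 2) ≤ 1 := re_anchor_le_one hσ2 hz1 hq
  -- (2) `σ q₀ ≤ 1`
  have hq0 : q₀ ^ 2 ≤ 1 := by nlinarith [sq_nonneg (p 0), sq_nonneg (p 1), sq_nonneg (p 2)]
  have h2 : σ * q₀ ≤ 1 := by
    rcases hσ with h | h <;> subst h <;> nlinarith [sq_nonneg (q₀ - 1), sq_nonneg (q₀ + 1)]
  -- (3) the cross term: `|σ r⁻¹ q₀ (z·p)| ≤ 2ρ²` (Cauchy–Schwarz, `|q₀| ≤ 1`, `r⁻¹ ≤ √2 ≤ 2`)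
  have hcs : (z 0 * p 0 + z 1 * p 1 + z 2 * p 2) ^ 2 ≤ ρ ^ 2 * ρ ^ 2 := by
    have h := dot3_sq_le z p
    calc (z 0 * p 0 + z 1 * p 1 + z 2 * p 2) ^ 2 ≤ ((z 0) ^ 2 + (z 1) ^ 2 + (z 2) ^ 2) * ((p 0) ^ 2 + (p 1) ^ 2 + (p 2) ^ 2) := h
      _ ≤ ρ ^ 2 * ρ ^ 2 := mul_le_mul hz hp (by positivity) (by positivity)
  have hzp : |z 0 * p 0 + z 1 * p 1 + z 2 * p 2| ≤ ρ ^ 2 := by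
    have h := Real.abs_le_sqrt hcs
    rwa [show ρ ^ 2 * ρ ^ 2 = (ρ ^ 2) ^ 2 by ring, Real.sqrt_sq (by positivity)] at h
  have hrinv : r⁻¹ ≤ 2 := by
    rw [inv_le_comm₀ hrpos (by norm_num)]
    nlinarith
  have hrinv0 : 0 < r⁻¹ := inv_pos.2 hrpos
  have h3 : -(σ * r⁻¹ * q₀ * (z 0 * p 0 + z 1 * p 1 + z 2 * p 2)) ≤ 2 * ρ ^ 2 := by
    have habs : |σ * r⁻¹ * q₀ * (z 0 * p 0 + z 1 * p 1 + z 2 * p 2)| ≤ 2 * ρ ^ 2 := by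
      have hσ1 : |σ| = 1 := by rcases hσ with h | h <;> simp [h]
      have hq0' : |q₀| ≤ 1 := by
        have h := Real.abs_le_sqrt hq0; rwa [Real.sqrt_one] at h
      rw [abs_mul, abs_mul, abs_mul, hσ1, one_mul, abs_of_pos hrinv0]
      calc r⁻¹ * |q₀| * |z 0 * p 0 + z 1 * p 1 + z 2 * p 2| ≤ 2 * 1 * ρ ^ 2 :=
            mul_le_mul (mul_le_mul hrinv hq0' (abs_nonneg _) (by norm_num)) hzp (abs_nonneg _) (by norm_num)
        _ = 2 * ρ ^ 2 := by ring
    linarith [(abs_le.1 habs).1]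
  -- assemble: `3q₀² + 2|p|² = 3 − |p|² ≥ 3 − ρ²`
  have h4 : 3 * q₀ ^ 2 + 2 * ((p 0) ^ 2 + (p 1) ^ 2 + (p 2) ^ 2) = 3 - ((p 0) ^ 2 + (p 1) ^ 2 + (p 2) ^ 2) := by nlinarith
  have hN0 : N ≠ 0 := hN.ne'
  have hAN : 3 * (σ * r * q₀ + (z 0 * p 0 + z 1 * p 1 + z 2 * p 2)) * N ≤ 3 * N := by nlinarith [h1, hN]
  have key : 3 * (σ * r * q₀ + (z 0 * p 0 + z 1 * p 1 + z 2 * p 2)) * N -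
      (3 - ((p 0) ^ 2 + (p 1) ^ 2 + (p 2) ^ 2) + σ * r⁻¹ * q₀ * (z 0 * p 0 + z 1 * p 1 + z 2 * p 2)) + (3 / 2) * σ * q₀ ≤
      3 * N - 3 / 2 + 3 * ρ ^ 2 := by linarith [hAN, h2, h3, hp]
  rw [h4]
  have e1 : 3 * (σ * r * q₀ + (z 0 * p 0 + z 1 * p 1 + z 2 * p 2)) -
        (3 - ((p 0) ^ 2 + (p 1) ^ 2 + (p 2) ^ 2) + σ * r⁻¹ * q₀ * (z 0 * p 0 + z 1 * p 1 + z 2 * p 2)) / N + (3 / 2 : ℝ) * σ * q₀ / N =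
      (3 * (σ * r * q₀ + (z 0 * p 0 + z 1 * p 1 + z 2 * p 2)) * N -
        (3 - ((p 0) ^ 2 + (p 1) ^ 2 + (p 2) ^ 2) + σ * r⁻¹ * q₀ * (z 0 * p 0 + z 1 * p 1 + z 2 * p 2)) + (3 / 2) * σ * q₀) / N := by
    field_simp
  have e2 : (3 : ℝ) - (3 / 2) / N + 3 * ρ ^ 2 / N = (3 * N - 3 / 2 + 3 * ρ ^ 2) / N := by
    field_simp
  rw [e1, e2]
  exact div_le_div_of_nonneg_right key hN.le

/-- The budget arithmetic of the divergence clause: `3·(6L⁴ + 1) − 4·(3/2) = 18L⁴ − 3`. [folklore] -/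
theorem budget_arith (Lr : ℝ) : 3 * (6 * Lr ^ 4 + 1) - 4 * (3 / 2 : ℝ) = 18 * Lr ^ 4 - 3 := by ring

end Summit.QuantumFields.YangMills.Theorems.VirialFluxGap.CentralField

end
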